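import Literature.AnabelianGeometry.SemiGraphs.TemperedAnabelian
import Mathlib.Topology.Algebra.ClopenNhdofOne

/-!
# Profinite completions: the universal property from the interface axioms
# ("profinite completion yields `φ̂ : Π_{X_K} → Π_{Y_L}`", [SemiAnbd] Thm. 6.4 proof)

Mochizuki, *Semi-graphs of anabelioids*, Publ. RIMS **42** (2006) [SemiAnbd], §6 p. 69 ("we shall
denote the profinite completion of a group by means of a `∧`") and the proof of Theorem 6.4 p. 71
("given a homomorphism `φ : Π^temp_{X_K} → Π^temp_{Y_L}` of DOF-type, profinite completion yields an
open homomorphism `φ̂ : Π_{X_K} → Π_{Y_L}`"). [cite: MochizukiSemiAnbd2006, §6 p.69, Thm 6.4 proof p.71]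

PROOF-ONLY companion of `TemperedAnabelian.lean` (abc-iut cell, prover abc-iut-w5-d139; sub-DAG
`SemiAnbd:Thm6.4`, row T64-L03a `TemperedCurve.CompletionExtends`, generic form): the UNIVERSAL PROPERTY
of the profinite completion, derived from the interface `IsProfiniteCompletion ι` (compact Hausdorff
totally disconnected `F̂`, dense range, every open normal subgroup of finite index of `F` is pulled back
from `F̂`): every continuous homomorphism `ψ : F → P` into a profinite group `P` extends along `ι` to a
continuous homomorphism `F̂ → P` (`exists_extension`; unique by density).  Proof: the closure `Γ` of
the graph `{(ι x, ψ x)}` in `F̂ × P` is a closed subgroup which is (i) total over `F̂` (its projection is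
compact and contains the dense `ι(F)`) and (ii) single-valued — `(1, p) ∈ Γ` forces `p ∈ V` for every
open normal `V ≤ P`, because `ψ⁻¹(V)` is open normal of finite index, hence `= ι⁻¹(W)` for an open
normal `W ≤ F̂`, and the neighbourhood `W × pV` of `(1, p)` meets the graph; so `Γ` is the graph of a
homomorphism, continuous by the closed-graph/compactness argument.  Classical; Mathlib only; no new
definition, no fact. Nothing here takes a side on [IUTchIII] Cor. 3.12.
-/

noncomputable section

namespace Literature.AnabelianGeometry.SemiGraphs

namespace IsProfiniteCompletion

open Topology

universe u v w

variable {F : Type u} {Fhat : Type v} [Group F] [TopologicalSpace F]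
  [Group Fhat] [TopologicalSpace Fhat] [IsTopologicalGroup Fhat] {ι : F →ₜ* Fhat}
  {P : Type w} [Group P] [TopologicalSpace P] [IsTopologicalGroup P] [CompactSpace P]
  [TotallyDisconnectedSpace P]

omit [TotallyDisconnectedSpace P] in
/-- The preimage of an open normal subgroup of a compact group under a continuous homomorphism is an
open normal subgroup of finite index. [folklore] -/
private theorem finiteIndex_comap_openNormal (ψ : F →ₜ* P) (V : OpenNormalSubgroup P) :
    (V.toSubgroup.comap ψ.toMonoidHom).FiniteIndex := by
  haveI : V.toSubgroup.FiniteIndex := Subgroup.finiteIndex_of_finite_quotient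
  haveI : V.toSubgroup.IsFiniteRelIndex ψ.toMonoidHom.range := Subgroup.isFiniteRelIndex_of_finiteIndex
  exact ⟨by rw [Subgroup.index_comap]; exact Subgroup.relIndex_ne_zero⟩

/-- **Universal property of the profinite completion, from the interface axioms** ([SemiAnbd] §6
p. 69; used in the proof of Thm. 6.4 p. 71 as "profinite completion yields `φ̂ : Π_{X_K} → Π_{Y_L}`"):
if `ι : F → F̂` is a profinite completion (`IsProfiniteCompletion ι`) and `P` is a profinite group, every
continuous homomorphism `ψ : F → P` extends along `ι` to a continuous homomorphism `Φ : F̂ → P`,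
`Φ ∘ ι = ψ`. [cite: MochizukiSemiAnbd2006, §6 p.69] -/
theorem exists_extension (hι : IsProfiniteCompletion ι) (ψ : F →ₜ* P) :
    ∃ Φ : Fhat →ₜ* P, ∀ x : F, Φ (ι x) = ψ x := by
  classical
  haveI : CompactSpace Fhat := hι.compactSpace
  haveI : T2Space Fhat := hι.t2Space
  -- the graph of `ψ` over `ι` and its closure `Γ`, a closed subgroup of `F̂ × P`
  let γ : F →* Fhat × P := MonoidHom.prod ι.toMonoidHom ψ.toMonoidHom
  have hγ : ∀ x : F, γ x = (ι x, ψ x) := fun x => rfl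
  let Γ : Subgroup (Fhat × P) := γ.range.topologicalClosure
  have hΓcoe : (Γ : Set (Fhat × P)) = closure ((γ.range : Subgroup (Fhat × P)) : Set (Fhat × P)) :=
    Subgroup.topologicalClosure_coe
  have hΓclosed : IsClosed (Γ : Set (Fhat × P)) := Subgroup.isClosed_topologicalClosure _
  have hγΓ : ∀ x : F, (ι x, ψ x) ∈ Γ := fun x =>
    Subgroup.le_topologicalClosure _ ⟨x, hγ x⟩
  -- (ii) the fibre of `Γ` over `1` is trivial
  have hker : ∀ p : P, ((1 : Fhat), p) ∈ Γ → p = 1 := by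
    intro p hp
    by_contra hne
    obtain ⟨V, hV⟩ := ProfiniteGrp.exist_openNormalSubgroup_sub_open_nhds_of_one
      (isOpen_compl_singleton (x := p)) (by simpa using fun h : (1 : P) = p => hne h.symm)
    -- `N := ψ⁻¹(V)`, open normal of finite index in `F`, is pulled back from `F̂`
    have hNopen : IsOpen ((V.toSubgroup.comap ψ.toMonoidHom : Subgroup F) : Set F) :=
      V.toOpenSubgroup.isOpen.preimage ψ.continuous
    let N : OpenNormalSubgroup F := ⟨⟨V.toSubgroup.comap ψ.toMonoidHom, hNopen⟩, inferInstance⟩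
    obtain ⟨W, hW⟩ := hι.comap_surjective N (finiteIndex_comap_openNormal ψ V)
    have hW' : V.toSubgroup.comap ψ.toMonoidHom = W.toSubgroup.comap ι.toMonoidHom := hW
    -- the neighbourhood `W × pV` of `(1, p)` meets the graph
    have hmem : ((1 : Fhat), p) ∈ closure ((γ.range : Subgroup (Fhat × P)) : Set (Fhat × P)) := by
      rw [← hΓcoe]
      exact hp
    have hopen : IsOpen ((W.toSubgroup : Set Fhat) ×ˢ ((fun v : P => p * v) '' (V.toSubgroup : Set P))) :=
      W.toOpenSubgroup.isOpen.prod ((Homeomorph.mulLeft p).isOpenMap _ V.toOpenSubgroup.isOpen)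
    have hin : ((1 : Fhat), p) ∈ (W.toSubgroup : Set Fhat) ×ˢ ((fun v : P => p * v) '' (V.toSubgroup : Set P)) :=
      ⟨W.toSubgroup.one_mem, 1, V.toSubgroup.one_mem, mul_one p⟩
    obtain ⟨w, ⟨hwW, v, hvV, hpv⟩, ⟨x, hx⟩⟩ := mem_closure_iff.mp hmem _ hopen hin
    rw [hγ x] at hx
    have hx1 : ι x = w.1 := congrArg Prod.fst hx
    have hx2 : ψ x = w.2 := congrArg Prod.snd hx
    -- `ι x ∈ W` gives `x ∈ ψ⁻¹(V)`, i.e. `ψ x ∈ V`; but `ψ x = p * v` with `v ∈ V`, so `p ∈ V`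
    have hxN : x ∈ V.toSubgroup.comap ψ.toMonoidHom := by
      rw [hW', Subgroup.mem_comap]
      show ι x ∈ W.toSubgroup
      rw [hx1]
      exact hwW
    have hψx : ψ x ∈ V.toSubgroup := hxN
    have hpV : p ∈ (V : Set P) := by
      have : p = ψ x * v⁻¹ := by rw [hx2, ← hpv, mul_inv_cancel_right]
      rw [this]
      exact V.toSubgroup.mul_mem hψx (V.toSubgroup.inv_mem hvV)
    exact hV hpV rfl
  -- (i) `Γ` is total over `F̂`
  have htot : ∀ z : Fhat, ∃ q : P, (z, q) ∈ Γ := by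
    intro z
    have hcl : IsClosed (Prod.fst '' (Γ : Set (Fhat × P))) :=
      (hΓclosed.isCompact.image continuous_fst).isClosed
    have hsub : Set.range ι ⊆ Prod.fst '' (Γ : Set (Fhat × P)) := by
      rintro _ ⟨x, rfl⟩
      exact ⟨(ι x, ψ x), hγΓ x, rfl⟩
    have hz : z ∈ Prod.fst '' (Γ : Set (Fhat × P)) := by
      have h : closure (Set.range ι) ⊆ Prod.fst '' (Γ : Set (Fhat × P)) := closure_minimal hsub hcl
      rw [hι.denseRange.closure_range] at h
      exact h (Set.mem_univ z)
    obtain ⟨⟨z', q⟩, hq, rfl⟩ := hz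
    exact ⟨q, hq⟩
  -- single-valuedness
  have huniq : ∀ (z : Fhat) (q q' : P), (z, q) ∈ Γ → (z, q') ∈ Γ → q = q' := by
    intro z q q' hq hq'
    have h : ((z, q)⁻¹ * (z, q') : Fhat × P) ∈ Γ := Γ.mul_mem (Γ.inv_mem hq) hq'
    have h' : ((1 : Fhat), q⁻¹ * q') ∈ Γ := by
      simpa [Prod.inv_mk, Prod.mk_mul_mk, inv_mul_cancel] using h
    exact inv_mul_eq_one.mp (hker _ h')
  choose Φf hΦf using htot
  have hgraph : ∀ (z : Fhat) (q : P), (z, q) ∈ Γ → q = Φf z := fun z q h => huniq z q _ h (hΦf z)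
  -- `Φf` is a homomorphism
  have hone : Φf 1 = 1 := (hgraph 1 1 Γ.one_mem).symm
  have hmul : ∀ a b : Fhat, Φf (a * b) = Φf a * Φf b := by
    intro a b
    refine (hgraph (a * b) (Φf a * Φf b) ?_).symm
    have := Γ.mul_mem (hΦf a) (hΦf b)
    simpa [Prod.mk_mul_mk] using this
  -- `Φf` is continuous: preimages of closed sets are projections of closed subsets of `F̂ × P`
  have hcont : Continuous Φf := by
    rw [continuous_iff_isClosed]
    intro C hC
    have hpre : Φf ⁻¹' C = Prod.fst '' ((Γ : Set (Fhat × P)) ∩ Set.univ ×ˢ C) := by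
      ext z
      constructor
      · intro hz
        exact ⟨(z, Φf z), ⟨hΦf z, Set.mem_univ _, hz⟩, rfl⟩
      · rintro ⟨⟨z', q⟩, ⟨hq, -, hqC⟩, rfl⟩
        show Φf z' ∈ C
        rw [← hgraph z' q hq]
        exact hqC
    rw [hpre]
    exact ((hΓclosed.inter (isClosed_univ.prod hC)).isCompact.image continuous_fst).isClosed
  refine ⟨{ toFun := Φf, map_one' := hone, map_mul' := hmul, continuous_toFun := hcont }, fun x => ?_⟩
  exact (hgraph (ι x) (ψ x) (hγΓ x)).symm

omit [IsTopologicalGroup Fhat] [IsTopologicalGroup P] [CompactSpace P] [TotallyDisconnectedSpace P] in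
/-- Uniqueness of the extension (density of `ι(F)`, `P` Hausdorff). [cite: MochizukiSemiAnbd2006, §6 p.69] -/
theorem extension_unique [T2Space P] (hι : IsProfiniteCompletion ι) (Φ Ψ : Fhat →ₜ* P)
    (h : ∀ x : F, Φ (ι x) = Ψ (ι x)) : Φ = Ψ := by
  have heq : (Φ : Fhat → P) = Ψ :=
    Continuous.ext_on hι.denseRange Φ.continuous Ψ.continuous fun y ⟨x, hx⟩ => by subst hx; exact h x
  exact ContinuousMonoidHom.ext fun z => congrFun heq z

end IsProfiniteCompletion

end Literature.AnabelianGeometry.SemiGraphs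

end
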